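/-
Copyright: rh-split cell (screw, prover seat l19) gen 3, 2026-08-27.  Splitting search over kernel-typed
RH-equivalences.  A splitting `A ∧ B ⟹ RH` is CONDITIONAL bookkeeping unless `A` and `B` are both
proved; nothing here bears on the truth of RH.
-/
import Summits.RiemannHypothesis.RiemannHypothesis.Theorems.Splittings.ScrewLatticePringsheim
import HarnessLib

/-!
# Route X-17 `ScrewMultisection` — the MULTISECTION BRIDGE (item `MultisectionBridge`, RH-free):
eventually `q`-periodic signs of `Ψ` on the lattice `hℕ` plus `q` wall-free rays give the
two-sided lattice ceiling `CEIL(h)`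

Objects of `ScrewLatticeContinuation` (row X-9): step `h > 0`, `Ψ = zetaScrew`, the lattice generating
function `P_h(z) = ∑_k Ψ(k h) z^k` (= the Borel series `B_h(z) = ∑_ρ term (c_ρ) (u_ρ) z` for
`‖z‖ < e^{-h/2}`, `latticeGF_eq_borel`), the wall `T_h = closure (aliasedPoleSet h)`,
`aliasedPoleSet h = poleSet (mult h)`, and `CEIL(h) = LatticeCeiling h` (`|Ψ(k h)| ≤ K_ε e^{ε k}`).

**Theorem** (`latticeCeiling_of_periodicSigns_of_raysFree`; `multisectionBridge` is the statement of
`Theses.ScrewMultisection.MultisectionBridge` verbatim).  Let `h > 0`, `q ≥ 1`.  Suppose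
* (signs) the SIGN PATTERN of `Ψ` on `hℕ` is eventually `q`-periodic:
  `∃ K ∀ k ≥ K, (Ψ(k h) < 0 ⟺ Ψ((k+q) h) < 0)`;
* (rays) the `q` rays `{t e^{2πi j/q} : t ∈ [0,1)}` miss the wall `T_h`.
Then `CEIL(h)`.

Proof (root-of-unity multisection + Vivanti–Pringsheim per residue class).
* §1 `sum_rootOfUnity_filter`: `∑_{j<q} e^{-2πi j a/q} (e^{2πi j/q})^k = q·[k ≡ a (mod q)]` (`a < q`).
* §2 `hasSum_classFilter`: the ROOT-OF-UNITY FILTER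
  `F_{q,a}(z) = (1/q) ∑_{j<q} e^{-2πi j a/q} B_h(e^{2πi j/q} z)` sums the class sub-series
  `∑_{k ≡ a} Ψ(k h) z^k` for `‖z‖ < e^{-h/2}` (`hasSum_latticeGF`, `latticeGF_eq_borel`, §1).
* §3 `analyticAt_classFilter`: `F_{q,a}` is analytic at every real `t ∈ [0,1)`, because each rotated
  point `e^{2πi j/q} t` lies in the open set `𝔻 ∖ T_h` on which `B_h` is holomorphic
  (`ScrewBorel.differentiableOn_borel`) — this is where (rays) is used.
* §4 `exists_sign_of_periodic`: under (signs) every residue class `a (mod q)` is eventually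
  ONE-SIGNED: there is `s_a ∈ {±1}` with `|Ψ(k h)| = s_a Ψ(k h)` for all `k ≥ K`, `k ≡ a`.
* §5 `summable_class_of_periodic`: the function `s_a F_{q,a} + P_a` (`P_a` the polynomial correcting
  the finitely many terms `k < K`) is analytic on `[0,1)` and near `0⁺` it is the sum of the series
  `∑_{k ≡ a} |Ψ(k h)| t^k` with NON-NEGATIVE coefficients; the Vivanti–Pringsheim theorem
  (`Literature.Analysis.Complex.summable_mul_pow_of_nonneg_of_analyticAt`) makes that series
  converge for every `t ∈ [0,1)`.
* §6 Summing over `a < q`: `∑_k |Ψ(k h)| t^k < ∞` on `[0,1)`; at `t = e^{-ε}` every term is at most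
  the sum: `|Ψ(k h)| ≤ T e^{ε k}`, i.e. `CEIL(h)` (`latticeCeiling_of_summable_abs`).

RH is not proved by this: `MultisectionBridge` is the RH-free leg of the CONDITIONAL splitting X-17
`MultisectionBridge ∧ PeriodicSignsRaysFree ∧ ThinWallOne ⟹ RH` (`PeriodicSignsRaysFree`,
`ThinWallOne` open, RH-implied).  No `sorry`, no new axioms, no instances, no notation.
-/

set_option linter.dupNamespace false

namespace Summit.RiemannHypothesis.RiemannHypothesis.Theorems.Splittings.ScrewLatticeMultisection

open Filter Topology Set Metric
open Literature.NumberTheory.LFunctions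
open Summit.RiemannHypothesis.RiemannHypothesis.Theorems.Splittings
open Summit.RiemannHypothesis.RiemannHypothesis.Theorems.Splittings.ScrewBorel
open Summit.RiemannHypothesis.RiemannHypothesis.Theorems.Splittings.ScrewLatticeContinuation
open Summit.RiemannHypothesis.RiemannHypothesis.Theorems.Splittings.ScrewLatticePringsheim

/-! ## §1 Root-of-unity orthogonality -/

/-- `‖e^{2πi j/q}‖ = 1`. -/
theorem norm_rootOfUnity (q j : ℕ) :
    ‖Complex.exp (2 * Real.pi * Complex.I * ((j : ℂ) / (q : ℂ)))‖ = 1 := by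
  have e : 2 * (Real.pi : ℂ) * Complex.I * ((j : ℂ) / (q : ℂ)) =
      ((2 * Real.pi * ((j : ℝ) / (q : ℝ)) : ℝ) : ℂ) * Complex.I := by
    push_cast; ring
  rw [e, Complex.norm_exp_ofReal_mul_I]

/-- **Orthogonality of the `q`-th roots of unity** (`0 < q`, `a < q`):
`∑_{j<q} e^{-2πi j a/q} (e^{2πi j/q})^k = q` if `k ≡ a (mod q)` and `= 0` otherwise. -/
theorem sum_rootOfUnity_filter {q : ℕ} (hq : 0 < q) {a : ℕ} (ha : a < q) (k : ℕ) :
    ∑ j ∈ Finset.range q, Complex.exp (-(2 * Real.pi * Complex.I * ((j : ℂ) * (a : ℂ) / (q : ℂ)))) *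
        Complex.exp (2 * Real.pi * Complex.I * ((j : ℂ) / (q : ℂ))) ^ k =
      if k % q = a then (q : ℂ) else 0 := by
  have hq0 : (q : ℂ) ≠ 0 := Nat.cast_ne_zero.2 hq.ne'
  set ζ : ℂ := Complex.exp (2 * Real.pi * Complex.I * (((k : ℂ) - (a : ℂ)) / (q : ℂ))) with hζ
  -- each summand is `ζ ^ j`
  have hterm : ∀ j : ℕ,
      Complex.exp (-(2 * Real.pi * Complex.I * ((j : ℂ) * (a : ℂ) / (q : ℂ)))) *
        Complex.exp (2 * Real.pi * Complex.I * ((j : ℂ) / (q : ℂ))) ^ k = ζ ^ j := by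
    intro j
    rw [hζ, ← Complex.exp_nat_mul, ← Complex.exp_nat_mul, ← Complex.exp_add]
    congr 1
    ring
  rw [Finset.sum_congr rfl fun j _ ↦ hterm j]
  -- `ζ ^ q = 1`
  have hζq : ζ ^ q = 1 := by
    rw [hζ, ← Complex.exp_nat_mul]
    have e : (q : ℂ) * (2 * Real.pi * Complex.I * (((k : ℂ) - (a : ℂ)) / (q : ℂ))) =
        ((k : ℂ) - (a : ℂ)) * (2 * Real.pi * Complex.I) := by
      field_simp
    have h7 := Complex.exp_int_mul_two_pi_mul_I ((k : ℤ) - (a : ℤ))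
    push_cast at h7
    rw [e]
    exact h7
  by_cases hka : k % q = a
  · -- `k ≡ a (mod q)`: `ζ = 1` and the sum is `q`
    have hζ1 : ζ = 1 := by
      have hmod : a ≡ k [MOD q] := by
        show a % q = k % q
        rw [hka, Nat.mod_eq_of_lt ha]
      obtain ⟨m, hm⟩ := (Nat.modEq_iff_dvd.1 hmod)
      have hm' : (k : ℂ) - (a : ℂ) = (q : ℂ) * (m : ℂ) := by exact_mod_cast hm
      rw [hζ, hm', Complex.exp_eq_one_iff]
      exact ⟨m, by field_simp⟩
    rw [if_pos hka, hζ1]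
    simp
  · -- `k ≢ a (mod q)`: `ζ ≠ 1` and the geometric sum vanishes
    have hζ1 : ζ ≠ 1 := by
      intro h1
      rw [hζ, Complex.exp_eq_one_iff] at h1
      obtain ⟨n, hn⟩ := h1
      have h2πI : (2 * (Real.pi : ℂ) * Complex.I) ≠ 0 :=
        mul_ne_zero (mul_ne_zero two_ne_zero (Complex.ofReal_ne_zero.2 Real.pi_ne_zero))
          Complex.I_ne_zero
      have h2 : ((k : ℂ) - (a : ℂ)) / (q : ℂ) = (n : ℂ) :=
        mul_left_cancel₀ h2πI (by rw [hn]; ring)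
      have h3 : (k : ℂ) - (a : ℂ) = (n : ℂ) * (q : ℂ) := (div_eq_iff hq0).1 h2
      have h4 : (k : ℤ) - (a : ℤ) = n * (q : ℤ) := by exact_mod_cast h3
      have h5 : (q : ℤ) ∣ (k : ℤ) - (a : ℤ) := ⟨n, by rw [h4, mul_comm]⟩
      have h6 : a % q = k % q := (Nat.modEq_iff_dvd (n := q) (a := a) (b := k)).2 h5
      exact hka (by rw [← h6, Nat.mod_eq_of_lt ha])
    rw [if_neg hka, geom_sum_eq hζ1, hζq, sub_self, zero_div]

/-- The filter applied to a monomial: `(1/q) ∑_{j<q} e^{-2πi j a/q} · (x (e^{2πi j/q} z)^k)` equals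
`[k ≡ a (mod q)] · x z^k` (`a < q`). -/
theorem rootOfUnity_filter_monomial {q : ℕ} (hq : 0 < q) {a : ℕ} (ha : a < q) (k : ℕ) (x z : ℂ) :
    (q : ℂ)⁻¹ * ∑ j ∈ Finset.range q,
        Complex.exp (-(2 * Real.pi * Complex.I * ((j : ℂ) * (a : ℂ) / (q : ℂ)))) *
          (x * (Complex.exp (2 * Real.pi * Complex.I * ((j : ℂ) / (q : ℂ))) * z) ^ k) =
      (if k % q = a then x else 0) * z ^ k := by
  have hq0 : (q : ℂ) ≠ 0 := Nat.cast_ne_zero.2 hq.ne'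
  have e1 : ∀ j : ℕ,
      Complex.exp (-(2 * Real.pi * Complex.I * ((j : ℂ) * (a : ℂ) / (q : ℂ)))) *
          (x * (Complex.exp (2 * Real.pi * Complex.I * ((j : ℂ) / (q : ℂ))) * z) ^ k) =
        (x * z ^ k) * (Complex.exp (-(2 * Real.pi * Complex.I * ((j : ℂ) * (a : ℂ) / (q : ℂ)))) *
          Complex.exp (2 * Real.pi * Complex.I * ((j : ℂ) / (q : ℂ))) ^ k) := by
    intro j
    rw [mul_pow]
    ring
  rw [Finset.sum_congr rfl fun j _ ↦ e1 j, ← Finset.mul_sum, sum_rootOfUnity_filter hq ha k]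
  split_ifs with hka
  · field_simp
  · simp

/-! ## §2 The root-of-unity filter of the Borel continuation sums the class sub-series near `0` -/

/-- **The multisection germ.**  For `h > 0`, `0 < q`, `a < q` and `‖z‖ < e^{-h/2}`:
`HasSum (k ↦ [k ≡ a (mod q)] Ψ(k h) z^k) ((1/q) ∑_{j<q} e^{-2πi j a/q} B_h(e^{2πi j/q} z))`,
where `B_h(w) = ∑_ρ term (c_ρ) (u_ρ) w` is the Borel continuation of the lattice generating function. -/
theorem hasSum_classFilter {h : ℝ} (hh : 0 < h) {q : ℕ} (hq : 0 < q) {a : ℕ} (ha : a < q) {z : ℂ}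
    (hz : ‖z‖ < Real.exp (-(h / 2))) :
    HasSum (fun k : ℕ ↦ (if k % q = a then (zetaScrew (k * h) : ℂ) else 0) * z ^ k)
      ((q : ℂ)⁻¹ * ∑ j ∈ Finset.range q,
        Complex.exp (-(2 * Real.pi * Complex.I * ((j : ℂ) * (a : ℂ) / (q : ℂ)))) *
          ∑' ρ : ZetaZeros.riemannZetaNontrivialZeros, term (coeff ρ) (mult h ρ)
            (Complex.exp (2 * Real.pi * Complex.I * ((j : ℂ) / (q : ℂ))) * z)) := by
  -- each rotated series
  have hrot : ∀ j ∈ Finset.range q, HasSum (fun k : ℕ ↦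
      Complex.exp (-(2 * Real.pi * Complex.I * ((j : ℂ) * (a : ℂ) / (q : ℂ)))) *
        ((zetaScrew (k * h) : ℂ) *
          (Complex.exp (2 * Real.pi * Complex.I * ((j : ℂ) / (q : ℂ))) * z) ^ k))
      (Complex.exp (-(2 * Real.pi * Complex.I * ((j : ℂ) * (a : ℂ) / (q : ℂ)))) *
        ∑' ρ : ZetaZeros.riemannZetaNontrivialZeros, term (coeff ρ) (mult h ρ)
          (Complex.exp (2 * Real.pi * Complex.I * ((j : ℂ) / (q : ℂ))) * z)) := by
    intro j _
    have hzj : ‖Complex.exp (2 * Real.pi * Complex.I * ((j : ℂ) / (q : ℂ))) * z‖ <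
        Real.exp (-(h / 2)) := by
      rwa [norm_mul, norm_rootOfUnity, one_mul]
    have h1 := hasSum_latticeGF hh hzj
    rw [latticeGF_eq_borel hh hzj] at h1
    exact h1.mul_left _
  have hsum := (hasSum_sum hrot).mul_left ((q : ℂ)⁻¹)
  refine hsum.congr_fun fun k ↦ ?_
  exact (rootOfUnity_filter_monomial hq ha k _ z).symm

/-! ## §3 The filter is analytic along the ray when the rotated rays are wall-free -/

/-- **Analyticity of the filter on `[0,1)`.**  If the `q` rays `t e^{2πi j/q}` (`t ∈ [0,1)`) miss the
wall `closure (aliasedPoleSet h)`, then for every `a` and every real `t ∈ [0,1)` the filter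
`z ↦ (1/q) ∑_{j<q} e^{-2πi j a/q} B_h(e^{2πi j/q} z)` is analytic at `t`
(`B_h` is holomorphic on the open set `ball 0 1 ∖ closure (poleSet (mult h))`, `differentiableOn_borel`). -/
theorem analyticAt_classFilter {h : ℝ} {q : ℕ} (a : ℕ)
    (hrays : ∀ j : ℕ, ∀ t : ℝ, 0 ≤ t → t < 1 →
      (t : ℂ) * Complex.exp (2 * Real.pi * Complex.I * ((j : ℂ) / (q : ℂ))) ∉
        closure (aliasedPoleSet h))
    {t : ℝ} (ht0 : 0 ≤ t) (ht1 : t < 1) :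
    AnalyticAt ℂ (fun z : ℂ ↦ (q : ℂ)⁻¹ * ∑ j ∈ Finset.range q,
        Complex.exp (-(2 * Real.pi * Complex.I * ((j : ℂ) * (a : ℂ) / (q : ℂ)))) *
          ∑' ρ : ZetaZeros.riemannZetaNontrivialZeros, term (coeff ρ) (mult h ρ)
            (Complex.exp (2 * Real.pi * Complex.I * ((j : ℂ) / (q : ℂ))) * z)) (t : ℂ) := by
  have hU : IsOpen (ball (0 : ℂ) 1 \ closure (poleSet (mult h))) :=
    isOpen_ball.sdiff isClosed_closure
  have hB := differentiableOn_borel summable_norm_coeff (mult_ne_zero h)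
  refine analyticAt_const.fun_mul (Finset.analyticAt_fun_sum _ fun j _ ↦
    analyticAt_const.fun_mul ?_)
  set W : ℂ := Complex.exp (2 * Real.pi * Complex.I * ((j : ℂ) / (q : ℂ))) with hW
  have hmem : W * (t : ℂ) ∈ ball (0 : ℂ) 1 \ closure (poleSet (mult h)) := by
    refine ⟨?_, ?_⟩
    · rw [mem_ball_zero_iff, norm_mul, hW, norm_rootOfUnity, one_mul, Complex.norm_real,
        Real.norm_eq_abs, abs_of_nonneg ht0]
      exact ht1
    · rw [mul_comm]
      exact hrays j t ht0 ht1
  have hBat : AnalyticAt ℂ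
      (fun w : ℂ ↦ ∑' ρ : ZetaZeros.riemannZetaNontrivialZeros, term (coeff ρ) (mult h ρ) w)
      (W * (t : ℂ)) :=
    hB.analyticAt (hU.mem_nhds hmem)
  have hlin : AnalyticAt ℂ (fun z : ℂ ↦ W * z) (t : ℂ) := analyticAt_const.fun_mul analyticAt_id
  exact hBat.comp hlin

/-! ## §4 Eventually periodic signs: every residue class is eventually one-signed -/

/-- If the sign pattern `k ↦ [f k < 0]` is `q`-periodic from `K` on, then two indices `≥ K` in the same
residue class mod `q` carry the same sign. -/
theorem sign_iff_of_periodic {f : ℕ → ℝ} {q K : ℕ}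
    (hper : ∀ k : ℕ, K ≤ k → (f k < 0 ↔ f (k + q) < 0)) {k m : ℕ} (hk : K ≤ k) (hm : K ≤ m)
    (hkm : k % q = m % q) : (f k < 0 ↔ f m < 0) := by
  -- steps of `q`
  have hstep : ∀ n k : ℕ, K ≤ k → (f k < 0 ↔ f (k + q * n) < 0) := by
    intro n
    induction n with
    | zero => intro k _; simp
    | succ n ih =>
      intro k hk
      rw [ih k hk, hper (k + q * n) (hk.trans (Nat.le_add_right _ _)),
        show k + q * (n + 1) = k + q * n + q by ring]
  wlog hle : k ≤ m generalizing k m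
  · exact (this hm hk hkm.symm (by omega)).symm
  obtain ⟨n, hn⟩ : ∃ n, m = k + q * n := by
    obtain ⟨n, hn⟩ := Nat.dvd_of_mod_eq_zero (Nat.sub_mod_eq_zero_of_mod_eq hkm.symm)
    refine ⟨n, ?_⟩
    rw [← hn]
    exact (Nat.add_sub_of_le hle).symm
  rw [hn]
  exact hstep n k hk

/-- **Eventual sign of a class.**  Under `q`-periodicity of the sign pattern from `K` on, every residue
class `a` has a sign `s ∈ {1, -1}` with `|f k| = s · f k` for all `k ≥ K` with `k % q = a`. -/
theorem exists_sign_of_periodic {f : ℕ → ℝ} {q K : ℕ}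
    (hper : ∀ k : ℕ, K ≤ k → (f k < 0 ↔ f (k + q) < 0)) (a : ℕ) :
    ∃ s : ℝ, (s = 1 ∨ s = -1) ∧ ∀ k : ℕ, K ≤ k → k % q = a → |f k| = s * f k := by
  by_cases hneg : ∃ m, K ≤ m ∧ m % q = a ∧ f m < 0
  · obtain ⟨m, hKm, hma, hfm⟩ := hneg
    refine ⟨-1, Or.inr rfl, fun k hk hka ↦ ?_⟩
    have hfk : f k < 0 := (sign_iff_of_periodic hper hk hKm (by rw [hka, hma])).2 hfm
    rw [abs_of_neg hfk]
    ring
  · refine ⟨1, Or.inl rfl, fun k hk hka ↦ ?_⟩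
    have hfk : ¬ f k < 0 := fun hfk ↦ hneg ⟨k, hk, hka, hfk⟩
    rw [abs_of_nonneg (not_lt.1 hfk), one_mul]

/-! ## §5 Vivanti–Pringsheim on one residue class -/

/-- **Ray summability of one class.**  `h > 0`, `0 < q`, `a < q`; the sign pattern of `Ψ` on `hℕ` is
`q`-periodic from `K` on, and the `q` rays miss the wall.  Then `∑_{k ≡ a} |Ψ(k h)| t^k` converges for
every `t ∈ [0,1)`. -/
theorem summable_class_of_periodic {h : ℝ} (hh : 0 < h) {q : ℕ} (hq : 0 < q) {a : ℕ} (ha : a < q)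
    {K : ℕ} (hper : ∀ k : ℕ, K ≤ k → (zetaScrew (k * h) < 0 ↔ zetaScrew ((k + q : ℕ) * h) < 0))
    (hrays : ∀ j : ℕ, ∀ t : ℝ, 0 ≤ t → t < 1 →
      (t : ℂ) * Complex.exp (2 * Real.pi * Complex.I * ((j : ℂ) / (q : ℂ))) ∉
        closure (aliasedPoleSet h))
    {t : ℝ} (ht0 : 0 ≤ t) (ht1 : t < 1) :
    Summable (fun k : ℕ ↦ (if k % q = a then |zetaScrew (k * h)| else 0) * t ^ k) := by
  -- the eventual sign of the class
  obtain ⟨s, hs, hsign⟩ :=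
    exists_sign_of_periodic (f := fun k : ℕ ↦ zetaScrew (k * h)) (q := q) (K := K) hper a
  -- non-negative coefficients and the early-term correction
  set c : ℕ → ℝ := fun k ↦ if k % q = a then |zetaScrew (k * h)| else 0 with hc
  set d : ℕ → ℝ := fun k ↦
    if k < K ∧ k % q = a then |zetaScrew (k * h)| - s * zetaScrew (k * h) else 0 with hd
  have hc0 : ∀ k, 0 ≤ c k := fun k ↦ by
    simp only [hc]
    split_ifs
    exacts [abs_nonneg _, le_rfl]
  have hcd : ∀ k : ℕ,
      c k = s * (if k % q = a then zetaScrew (k * h) else 0) + d k := by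
    intro k
    simp only [hc, hd]
    by_cases hka : k % q = a
    · by_cases hkK : k < K
      · rw [if_pos hka, if_pos hka, if_pos ⟨hkK, hka⟩]
        ring
      · rw [if_pos hka, if_pos hka, if_neg (fun h' ↦ hkK h'.1), add_zero]
        exact hsign k (not_lt.1 hkK) hka
    · rw [if_neg hka, if_neg hka, if_neg (fun h' ↦ hka h'.2), mul_zero, add_zero]
  -- the analytic function `F = s · (filter) + (polynomial correction)`
  set Φ : ℂ → ℂ := fun z ↦ (q : ℂ)⁻¹ * ∑ j ∈ Finset.range q,
      Complex.exp (-(2 * Real.pi * Complex.I * ((j : ℂ) * (a : ℂ) / (q : ℂ)))) *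
        ∑' ρ : ZetaZeros.riemannZetaNontrivialZeros, term (coeff ρ) (mult h ρ)
          (Complex.exp (2 * Real.pi * Complex.I * ((j : ℂ) / (q : ℂ))) * z) with hΦ
  set F : ℂ → ℂ := fun z ↦ (s : ℂ) * Φ z + ∑ k ∈ Finset.range K, (d k : ℂ) * z ^ k with hF
  have hFan : ∀ u : ℝ, 0 ≤ u → u < 1 → AnalyticAt ℂ F u := by
    intro u hu0 hu1
    have hΦan : AnalyticAt ℂ Φ u := analyticAt_classFilter a hrays hu0 hu1
    have hP : AnalyticAt ℂ (fun z : ℂ ↦ ∑ k ∈ Finset.range K, (d k : ℂ) * z ^ k) u :=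
      Finset.analyticAt_fun_sum _ fun k _ ↦ analyticAt_const.fun_mul (analyticAt_id.fun_pow k)
    exact (analyticAt_const.fun_mul hΦan).fun_add hP
  -- the germ at `0⁺`
  have hε : 0 < Real.exp (-(h / 2)) := Real.exp_pos _
  have hgerm : ∀ u : ℝ, 0 < u → u < Real.exp (-(h / 2)) →
      HasSum (fun k ↦ (c k : ℂ) * (u : ℂ) ^ k) (F u) := by
    intro u hu0 hue
    have hnu : ‖(u : ℂ)‖ < Real.exp (-(h / 2)) := by
      rwa [Complex.norm_real, Real.norm_eq_abs, abs_of_pos hu0]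
    have h1 := (hasSum_classFilter hh hq ha hnu).mul_left (s : ℂ)
    have h2 : HasSum (fun k ↦ (d k : ℂ) * (u : ℂ) ^ k)
        (∑ k ∈ Finset.range K, (d k : ℂ) * (u : ℂ) ^ k) := by
      refine hasSum_sum_of_ne_finset_zero fun k hk ↦ ?_
      have hdk : d k = 0 := by
        simp only [hd]
        exact if_neg fun h' ↦ hk (Finset.mem_range.2 h'.1)
      simp [hdk]
    refine (h1.add h2).congr_fun fun k ↦ ?_
    have e := hcd k
    by_cases hka : k % q = a
    · rw [if_pos hka] at e ⊢
      rw [e]; push_cast; ring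
    · rw [if_neg hka] at e ⊢
      rw [e]; push_cast; ring
  -- Vivanti–Pringsheim
  exact Literature.Analysis.Complex.summable_mul_pow_of_nonneg_of_analyticAt hc0 hFan hε hgerm ht0 ht1

/-! ## §6 All classes together: absolute ray summability and the ceiling -/

/-- **Absolute ray summability.**  `h > 0`, `0 < q`, `q`-periodic signs from `K` on, `q` wall-free rays:
`∑_k |Ψ(k h)| t^k` converges for every `t ∈ [0,1)`. -/
theorem summable_abs_mul_pow_of_periodic {h : ℝ} (hh : 0 < h) {q : ℕ} (hq : 0 < q) {K : ℕ}
    (hper : ∀ k : ℕ, K ≤ k → (zetaScrew (k * h) < 0 ↔ zetaScrew ((k + q : ℕ) * h) < 0))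
    (hrays : ∀ j : ℕ, ∀ t : ℝ, 0 ≤ t → t < 1 →
      (t : ℂ) * Complex.exp (2 * Real.pi * Complex.I * ((j : ℂ) / (q : ℂ))) ∉
        closure (aliasedPoleSet h))
    {t : ℝ} (ht0 : 0 ≤ t) (ht1 : t < 1) :
    Summable (fun k : ℕ ↦ |zetaScrew (k * h)| * t ^ k) := by
  have hcl : ∀ a ∈ Finset.range q,
      Summable (fun k : ℕ ↦ (if k % q = a then |zetaScrew (k * h)| else 0) * t ^ k) :=
    fun a ha ↦ summable_class_of_periodic hh hq (Finset.mem_range.1 ha) hper hrays ht0 ht1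
  refine (summable_sum hcl).congr fun k ↦ ?_
  rw [← Finset.sum_mul, Finset.sum_ite_eq, if_pos (Finset.mem_range.2 (Nat.mod_lt k hq))]

/-- **From absolute ray summability to the ceiling.**  If `∑_k |Ψ(k h)| t^k` converges for every
`t ∈ [0,1)`, then `CEIL(h)` (take `t = e^{-ε}`: every term is bounded by the sum). -/
theorem latticeCeiling_of_summable_abs {h : ℝ}
    (H : ∀ t : ℝ, 0 ≤ t → t < 1 → Summable (fun k : ℕ ↦ |zetaScrew (k * h)| * t ^ k)) :
    LatticeCeiling h := by
  intro ε hε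
  set t : ℝ := Real.exp (-ε) with ht
  have ht0 : 0 ≤ t := (Real.exp_pos _).le
  have ht1 : t < 1 := Real.exp_lt_one_iff.2 (by linarith)
  have hs := H t ht0 ht1
  have hterm0 : ∀ j : ℕ, 0 ≤ |zetaScrew (j * h)| * t ^ j :=
    fun j ↦ mul_nonneg (abs_nonneg _) (pow_nonneg ht0 j)
  refine ⟨∑' j : ℕ, |zetaScrew (j * h)| * t ^ j, fun k ↦ ?_⟩
  have hle : |zetaScrew (k * h)| * t ^ k ≤ ∑' j : ℕ, |zetaScrew (j * h)| * t ^ j :=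
    hs.le_tsum k fun j _ ↦ hterm0 j
  have htk : t ^ k = Real.exp (-(ε * k)) := by
    rw [ht, ← Real.exp_nat_mul]
    ring_nf
  have e1 : Real.exp (-(ε * k)) * Real.exp (ε * k) = 1 := by
    rw [← Real.exp_add]; simp
  calc |zetaScrew (k * h)| = |zetaScrew (k * h)| * t ^ k * Real.exp (ε * k) := by
        rw [htk, mul_assoc, e1, mul_one]
    _ ≤ (∑' j : ℕ, |zetaScrew (j * h)| * t ^ j) * Real.exp (ε * k) :=
        mul_le_mul_of_nonneg_right hle (Real.exp_pos _).le

/-! ## The bridge -/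

/-- **MULTISECTION BRIDGE** (`h > 0`, `q ≥ 1`, RH-free).  If the sign pattern of `Ψ` on the lattice
`hℕ` is eventually `q`-periodic and the `q` rays `t e^{2πi j/q}` (`t ∈ [0,1)`) miss the closed wall
`closure (aliasedPoleSet h)`, then `CEIL(h)`. -/
theorem latticeCeiling_of_periodicSigns_of_raysFree {h : ℝ} (hh : 0 < h) {q : ℕ} (hq : 0 < q)
    (hper : ∃ K : ℕ, ∀ k : ℕ, K ≤ k → (zetaScrew (k * h) < 0 ↔ zetaScrew ((k + q) * h) < 0))
    (hrays : ∀ j : ℕ, ∀ t : ℝ, 0 ≤ t → t < 1 →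
      (t : ℂ) * Complex.exp (2 * Real.pi * Complex.I * ((j : ℂ) / (q : ℂ))) ∉
        closure (aliasedPoleSet h)) :
    LatticeCeiling h := by
  obtain ⟨K, hK⟩ := hper
  have hK' : ∀ k : ℕ, K ≤ k → (zetaScrew (k * h) < 0 ↔ zetaScrew ((k + q : ℕ) * h) < 0) := by
    intro k hk
    exact_mod_cast hK k hk
  exact latticeCeiling_of_summable_abs fun t ht0 ht1 ↦
    summable_abs_mul_pow_of_periodic hh hq hK' hrays ht0 ht1

/-- **The statement of `Theses.ScrewMultisection.MultisectionBridge`** (verbatim, RH-free): for every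
step `h > 0` and period `q ≥ 1`, eventually `q`-periodic signs of `Ψ` on `hℕ` and `q` wall-free rays
give `LatticeCeiling h`. -/
theorem multisectionBridge :
    ∀ h : ℝ, 0 < h → ∀ q : ℕ, 0 < q →
      (∃ K : ℕ, ∀ k : ℕ, K ≤ k → (zetaScrew (k * h) < 0 ↔ zetaScrew ((k + q) * h) < 0)) →
      (∀ j : ℕ, ∀ t : ℝ, 0 ≤ t → t < 1 →
        (t : ℂ) * Complex.exp (2 * Real.pi * Complex.I * ((j : ℂ) / (q : ℂ))) ∉
          closure (aliasedPoleSet h)) →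
      LatticeCeiling h :=
  fun _ hh _ hq hper hrays ↦ latticeCeiling_of_periodicSigns_of_raysFree hh hq hper hrays

end Summit.RiemannHypothesis.RiemannHypothesis.Theorems.Splittings.ScrewLatticeMultisection
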